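/-
Copyright: lit-balaban cell, Phase-2 proof seat p24 (gen 25).  Released under Apache 2.0 license as described in the
file LICENSE.
-/
import Literature.MathematicalPhysics.QuantumFieldTheory.Balaban1983to89.B3GkZeroLattice
import Literature.MathematicalPhysics.QuantumFieldTheory.Balaban1983to89.B4Thm19ZeroBoxHolderRateUnif

/-!
# `Balaban1983to89.B4Thm19ZeroLattice` — [Balaban1983RegularityDecay] Theorem p. 573: the HÖLDER CLAUSE (1.9) and the
# DERIVATIVE CLAUSE of (1.10) FOR `Ω =` THE WHOLE LATTICE `ηℤ^{d+1}`, `A = 0`, every dimension, for the infinite-volume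
# propagator `G_k(0)` of [Balaban1983Higgs3] p. 433 (`B3GkZeroLattice.GkLat`)

statement-level skeleton of published theorems with citation tags; proofs where landed; nothing here is a claim about
the Yang–Mills mass gap

CITATION HEADER.  T. Bałaban, *Regularity and decay of lattice Green's functions*, Commun. Math. Phys. **89** (1983)
571–597, doi:10.1007/bf01214744 [Balaban1983RegularityDecay] (cell paper B4; held text
`paper:balaban1983-cmp89-regularity-decay`, journal page = PDF page + 570): p. 572 [PDF 2] (1.6), p. 573 [PDF 3] the
difference derivative `∂^η_μ`, the shortest contours `Γ_{x,x′}` and the Theorem with (1.9)–(1.10), p. 577–578 [PDF 7–8] the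
Hölder norm (2.14) and Lemma 2.2 (2.16)–(2.17); T. Bałaban, *(Higgs)₂,₃ quantum fields in a finite volume. III*, Commun.
Math. Phys. **88** (1983) 411–445 [Balaban1983Higgs3] (cell paper B3), p. 433 [PDF 23] («we substitute G_k(□,0) = G_k(0) +
δG_k(□,ηZ^d,0)»).  Unit `lit-balaban-p24` gen 25; HOME `run/shared/lean/pub/lit-balaban/`; SKELETON rows **B4.Thm@573**
(owner r01) and **B3.Txt@433** (owner r15) — cells only, both proved-headed.  Companion of `B4Thm110ZeroLattice` (the VALUE
clause of (1.10) and the `ℓ²` bridge); independent of it (imports only the box theorems and p03's `GkLat`).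

WHAT IS PRINTED (p. 573).  «[Of course ∂^η_μ is a difference derivative defined by (∂^η_μA)(x) = η^{−1}(A(x + ηe_μ) − A(x)).]»
… «Finally for an arbitrary pair of points x, x′ ∈ ηZ^d, let us denote by Γ_{x,x′} a shortest contour connecting these
points. … **Theorem** (Proposition 2.1 of [1]). For α < 1 there exist positive constants δ₀, c₀, R₀ independent of A, k, Ω
and depending on d, M only, c₀ on α also, such that for e sufficiently small and for an arbitrary function f : Ω → R^N, we
have (1/|x − x′|^α)|U(A(Γ_{x,x′}))(D^η_{A,μ}G_k(Ω,A)f)(x′) − (D^η_{A,μ}G_k(Ω,A)f)(x)| ≦ c₀exp(−δ₀dist({x,x′}, supp f))‖f‖_∞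
(1.9) for x, x′ ∈ Ω, and satisfying the condition dist({x,x′}, Ω^c) ≧ R₀. Similarly |(D^η_{A,μ}G_k(Ω,A)f)(x)|,
|(G_k(Ω,A)f)(x)| ≦ c₀exp(−δ₀dist(x, supp f))‖f‖_∞ (1.10) for x ∈ Ω, dist(x,Ω^c) ≧ R₀.»  For `Ω = ηℤ^{d+1}` (a union of big
blocks, p. 572) the conditions on `dist(·, Ω^c)` are vacuous; at `A = 0`, `U ≡ 1` and `D^η_{0,μ} = ∂^η_μ`.

WHAT THIS MODULE PROVES (kernel-checked; theorems only; 0 `def`; 0 `sorry`; axioms standard).  Matrix units of the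
zero-field lineage (`n = L^k = η^{−1}`, `L = ℓ + 1 ≥ 2`, running `a_k = B1.aSeq a L k`, window `a ∈ [a₋,a₊]`, `a₋ > 0`,
`m² ∈ [0,m²₊]`; `∂^η_μφ(x) = n(φ(x+e_μ) − φ(x))`, `G_k(0) = B3GkZeroLattice.GkLat`, `(G_k(0)f)(x) = Σ_{x′}G_k(0)(x,x′)f(x′)`):
* §1 **(1.10), DERIVATIVE CLAUSE, `Ω = ηℤ^{d+1}`**: `GkLat_weightedRowD_le` — `δ₀, c₀ > 0` (on `d`, `L`, the window) with
  `Σ_{z∈F}|n(G_k(0)(x+e_μ,z) − G_k(0)(x,z))|·e^{δ₀|x−z|_∞/n} ≤ c₀` for every finite `F`, axis `μ`, row `x`, `k ≥ 1`, window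
  point (`B4Thm110ZeroBoxDeriv.Gfine_rowwD_bound` on the centred cubes `C_t`, through `B3GkZeroLattice.tendsto_gcube`); hence
  the full series (`GkLat_weightedRowD_summable_tsum_le`), the pointwise form `GkLatD_abs_le`
  (`|∂^η_{μ,x}G_k(0)(x,z)| ≤ c₀e^{−δ₀|x−z|_∞/n}`; by the symmetry `GkLat_comm` this is also the derivative in the second
  variable), and THE PRINTED SHAPE `GkLatD_apply_le`: `|(∂^η_μG_k(0)f)(x)| ≤ c₀e^{−δ₀D/n}‖f‖_∞` for bounded `f` and every
  `D ≤ |x − x′|_∞` on `supp f`; and Lemma 2.2 (2.17) at the corner `q = p = 1` for `G_k(0)∂^{η*}_μ` («by duality argument», p. 583):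
  `GkLat_adjDeriv_apply_l1_le` — `Σ_x|Σ_z n(G_k(0)(z+e_μ,x) − G_k(0)(z,x))f(z)| ≤ c₀Σ_z|f(z)|` for finitely supported `f` (the kernel of
  `G_k(0)∂^{η*}_μ` is the transpose of that of `∂^η_μG_k(0)`, `GkLat_comm`; `q = p = ∞` for `∂^η_μG_k(0)` is `GkLatD_apply_le` at `D = 0`).
* §2 **(1.9), HÖLDER CLAUSE, `Ω = ηℤ^{d+1}`**, every `0 ≤ α < 1`: `GkLat_weightedRowH_le` — `δ₀, c₀ > 0` (on `d`, `L`, the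
  window and `α`) with `Σ_{z∈F}|(n/|x′−x|_∞)^α·n((G_k(0)(x′+e_μ,z) − G_k(0)(x′,z)) − (G_k(0)(x+e_μ,z) − G_k(0)(x,z)))|·
  e^{δ₀min(|x−z|_∞,|x′−z|_∞)/n} ≤ c₀` for all `x ≠ x′`, finite `F` (`B4Thm19ZeroBoxHolder.Gfine_rowwH_bound` in the limit),
  `GkLat_weightedRowH_le_unif` (the printed order of quantifiers: ONE `δ₀` for all `α`, `c₀ = c₀(α)`, from
  `B4Thm19ZeroBoxHolderRateUnif.Gfine_rowwH_bound_unif`), and THE PRINTED SHAPE `GkLatH_apply_le`: `(1/(η|x′−x|_∞)^α)|(∂^η_μG_k(0)f)(x′) − (∂^η_μG_k(0)f)(x)| ≤ c₀e^{−δ₀D/n}‖f‖_∞` for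
  bounded `f` and every `D ≤ dist_∞({x,x′}, supp f)` (fine units).
* §3 non-vacuity at `d + 1 = 4`, `L = 2`, `a ∈ [1/2, 2]`, `m² ∈ [0, 1]`, `α = 1/2`.

DICTIONARY / HONEST SCOPE.  (i) `A = 0`, one component, `Ω = ηℤ^{d+1}`, all `k ≥ 1`, `L ≥ 2`, `0 ≤ α < 1` (reading of record
G-ref1-32); distances in the sup norm and lattice units `/n`, as in the box lineage (print: Euclidean; exponent `δ₀/√(d+1)`);
constants existential on `d`, `L`, the window (and `α` for `c₀` of (1.9), as printed «c₀ on α also»; the rate `δ₀` is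
`α`-uniform in `GkLat_weightedRowH_le_unif`, `α`-dependent in the simpler `GkLat_weightedRowH_le`).  (ii) ROUTE (declared
divergence): the print proves the Theorem for a general union of big blocks by the random-walk expansion (§2); the member
`Ω = ηℤ^{d+1}`, `A = 0` is obtained from the LANDED box theorems (print's box route (2.34)/(2.38)–(2.39) + Lemma 2.4,
`B4Thm110ZeroBoxDeriv`, `B4Thm19ZeroBoxHolder`) in p03's infinite-volume limit — a shorter road inside the tree.  (iii) Value =
kernel certificate of (1.9) and of the derivative clause of (1.10) for the free infinite-lattice propagator; with
`B4Thm110ZeroLattice` the Theorem of p. 573 is in the tree for `Ω = ηℤ^{d+1}`, `A = 0` in every dimension; cells only; NOT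
summit progress.
-/

namespace Literature.MathematicalPhysics.QuantumFieldTheory.Balaban1983to89.B4Thm19ZeroLattice

open Finset Filter Topology Complex
open Literature.MathematicalPhysics.QuantumFieldTheory.Balaban1983to89.B4ContourShift (supNorm supNorm_nonneg)
open Literature.MathematicalPhysics.QuantumFieldTheory.Balaban1983to89.B4Reflection242
open Literature.MathematicalPhysics.QuantumFieldTheory.Balaban1983to89.B4BoxCov237
open Literature.MathematicalPhysics.QuantumFieldTheory.Balaban1983to89.B4Thm110ZeroBox
open Literature.MathematicalPhysics.QuantumFieldTheory.Balaban1983to89.B4Thm110ZeroBoxDeriv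
open Literature.MathematicalPhysics.QuantumFieldTheory.Balaban1983to89.B4Thm19ZeroBoxHolder
open Literature.MathematicalPhysics.QuantumFieldTheory.Balaban1983to89.B4Thm19ZeroBoxHolderRateUnif
open Literature.MathematicalPhysics.QuantumFieldTheory.Balaban1983to89.B3GkZeroLattice

noncomputable section

variable {d : ℕ}

/-! ## §0 Kernel helpers -/

/-- kernel: `L^k ≥ 1`. [folklore] -/
private theorem one_le_n (ℓ k : ℕ) : 1 ≤ (ℓ + 1) ^ k := Nat.one_le_pow _ _ (by omega)

/-- kernel: an injective relabelling of a finite partial sum of non-negative terms is dominated by the full finite sum.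
[folklore] -/
private theorem sum_attach_le_univ_sum {α β : Type*} [Fintype β] [DecidableEq β] (F : Finset α) (ι : ↥F → β)
    (hι : Function.Injective ι) (g : β → ℝ) (hg : ∀ b, 0 ≤ g b) :
    ∑ a ∈ F.attach, g (ι a) ≤ ∑ b, g b := by
  classical
  rw [← Finset.sum_image (f := g) (fun a _ b _ h => hι h)]
  exact Finset.sum_le_univ_sum_of_nonneg hg

/-- kernel: a common label radius for a finite set of points. [folklore] -/
private theorem exists_labRad_finset (n : ℕ) (F : Finset (Fin (d + 1) → ℤ)) :
    ∃ R : ℕ, ∀ x ∈ F, LabRad n R x := by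
  refine ⟨∑ x ∈ F, ∑ i, (blk n x i).natAbs, fun x hx => (labRad_sum n x).mono ?_⟩
  exact Finset.single_le_sum (f := fun y => ∑ i, (blk n y i).natAbs) (fun _ _ => Nat.zero_le _) hx

/-- kernel: centring commutes with a lattice step. [folklore] -/
private theorem ctr_add_single (n t : ℕ) (x : Fin (d + 1) → ℤ) (μ : Fin (d + 1)) :
    ctr n t (x + Pi.single μ 1) = ctr n t x + Pi.single μ 1 := by
  unfold ctr; exact add_right_comm _ _ _

/-- kernel: the centred points are injective in the point. [folklore] -/
private theorem ctr_injective (n t : ℕ) : Function.Injective (ctr (d := d) n t) :=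
  fun _ _ h => add_left_injective _ h

/-- kernel: **a weighted-`ℓ¹` kernel row applied to a bounded function** — if `Σ_{z∈F}|K z|·e^{w z} ≤ c₀` for all finite `F`,
`‖f z‖ ≤ F_∞` and `E ≤ w z` on `supp f`, then `Σ_z K(z)f(z)` converges absolutely and `|Σ_z K(z)f(z)| ≤ c₀e^{−E}F_∞`. [folklore] -/
private theorem tsum_mul_le_of_weighted {K w : (Fin (d + 1) → ℤ) → ℝ} {c₀ : ℝ}
    (hF : ∀ F : Finset (Fin (d + 1) → ℤ), ∑ z ∈ F, |K z| * Real.exp (w z) ≤ c₀)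
    {f : (Fin (d + 1) → ℤ) → ℂ} {Fsup E : ℝ} (hf : ∀ z, ‖f z‖ ≤ Fsup) (hE : ∀ z, f z ≠ 0 → E ≤ w z) :
    (Summable fun z => ((K z : ℝ) : ℂ) * f z) ∧
      ‖∑' z, ((K z : ℝ) : ℂ) * f z‖ ≤ c₀ * Real.exp (-E) * Fsup := by
  have hFsup : 0 ≤ Fsup := (norm_nonneg _).trans (hf 0)
  have hws : Summable fun z => |K z| * Real.exp (w z) :=
    summable_of_sum_le (fun _ => mul_nonneg (abs_nonneg _) (Real.exp_pos _).le) hF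
  have hwt : ∑' z, |K z| * Real.exp (w z) ≤ c₀ :=
    Real.tsum_le_of_sum_le (fun _ => mul_nonneg (abs_nonneg _) (Real.exp_pos _).le) hF
  set g : (Fin (d + 1) → ℤ) → ℝ := fun z => Real.exp (-E) * Fsup * (|K z| * Real.exp (w z)) with hg
  have hmaj : ∀ z, ‖((K z : ℝ) : ℂ) * f z‖ ≤ g z := by
    intro z
    by_cases hfz : f z = 0
    · rw [hfz, mul_zero, norm_zero, hg]
      exact mul_nonneg (mul_nonneg (Real.exp_pos _).le hFsup) (mul_nonneg (abs_nonneg _) (Real.exp_pos _).le)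
    · rw [norm_mul, Complex.norm_real, Real.norm_eq_abs, hg]
      have hexp : (1 : ℝ) ≤ Real.exp (-E) * Real.exp (w z) := by
        rw [← Real.exp_add]
        exact Real.one_le_exp (by linarith [hE z hfz])
      calc |K z| * ‖f z‖ ≤ |K z| * Fsup := mul_le_mul_of_nonneg_left (hf z) (abs_nonneg _)
        _ = |K z| * Fsup * 1 := (mul_one _).symm
        _ ≤ |K z| * Fsup * (Real.exp (-E) * Real.exp (w z)) :=
            mul_le_mul_of_nonneg_left hexp (mul_nonneg (abs_nonneg _) hFsup)
        _ = Real.exp (-E) * Fsup * (|K z| * Real.exp (w z)) := by ring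
  have hgs : Summable g := hws.mul_left _
  refine ⟨Summable.of_norm_bounded hgs hmaj, (tsum_of_norm_bounded hgs.hasSum hmaj).trans ?_⟩
  rw [hg, tsum_mul_left]
  calc Real.exp (-E) * Fsup * ∑' z, |K z| * Real.exp (w z) ≤ Real.exp (-E) * Fsup * c₀ :=
        mul_le_mul_of_nonneg_left hwt (mul_nonneg (Real.exp_pos _).le hFsup)
    _ = c₀ * Real.exp (-E) * Fsup := by ring


/-- kernel: a plain finite row sum is dominated by the exponentially weighted one (non-negative exponent). [folklore] -/
private theorem sum_abs_le_of_weighted {K w : (Fin (d + 1) → ℤ) → ℝ} {c₀ : ℝ} (hw : ∀ z, 0 ≤ w z)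
    (hF : ∀ F : Finset (Fin (d + 1) → ℤ), ∑ z ∈ F, |K z| * Real.exp (w z) ≤ c₀) (F : Finset (Fin (d + 1) → ℤ)) :
    ∑ z ∈ F, |K z| ≤ c₀ :=
  (Finset.sum_le_sum fun z _ => le_mul_of_one_le_right (abs_nonneg _) (Real.one_le_exp (hw z))).trans (hF F)

/-- kernel: … and the plain series converges with sum `≤ c₀`. [folklore] -/
private theorem summable_abs_of_weighted {K w : (Fin (d + 1) → ℤ) → ℝ} {c₀ : ℝ} (hw : ∀ z, 0 ≤ w z)
    (hF : ∀ F : Finset (Fin (d + 1) → ℤ), ∑ z ∈ F, |K z| * Real.exp (w z) ≤ c₀) :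
    Summable (fun z => |K z|) ∧ ∑' z, |K z| ≤ c₀ :=
  ⟨summable_of_sum_le (fun _ => abs_nonneg _) (sum_abs_le_of_weighted hw hF),
    Real.tsum_le_of_sum_le (fun _ => abs_nonneg _) (sum_abs_le_of_weighted hw hF)⟩

/-- kernel: the weight exponent of the lineage is non-negative. [folklore] -/
private theorem weight_nonneg {δ₀ : ℝ} (hδ₀ : 0 ≤ δ₀) (n : ℕ) (u : Fin (d + 1) → ℤ) :
    0 ≤ δ₀ * supNorm u / (n : ℝ) :=
  div_nonneg (mul_nonneg hδ₀ (supNorm_nonneg _)) (Nat.cast_nonneg _)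

/-! ## §1 (1.10), derivative clause, for `Ω = ηℤ^{d+1}`: `∂^η_μ G_k(0)` -/

/-- **(1.10), DERIVATIVE CLAUSE, FOR `Ω = ηℤ^{d+1}`, `A = 0` — THE UNIFORM WEIGHTED ROW BOUND FOR `∂^η_μG_k(0)`, finite
partial sums.**  There are `δ₀, c₀ > 0` (depending on `d`, `L = ℓ + 1` and the window only) such that for every `k ≥ 1`,
`a ∈ [a₋,a₊]`, `m² ∈ [0,m²₊]`, every axis `μ`, row `x` and finite `F ⊂ ℤ^{d+1}`:
`Σ_{z∈F} |n·(G_k(0)(x+e_μ,z) − G_k(0)(x,z))|·e^{δ₀|x−z|_∞/n} ≤ c₀` (`n = L^k`; `∂^η_μ = n·(shift − 1)` in fine units) — the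
box theorem `B4Thm110ZeroBoxDeriv.Gfine_rowwD_bound` on the centred cubes `C_t`, in the limit `t → ∞`
(`B3GkZeroLattice.tendsto_gcube`). [cite: Balaban1983RegularityDecay, Theorem (Prop. 2.1 of [1]) (1.10) p.573, derivative clause; dictionary (Ω = ηℤ^{d+1}, A = 0)] -/
theorem GkLat_weightedRowD_le (d ℓ : ℕ) (hℓ : 1 ≤ ℓ) (amin aplus m2plus : ℝ) (ha : 0 < amin) :
    ∃ δ₀ c₀ : ℝ, 0 < δ₀ ∧ 0 < c₀ ∧ ∀ (k : ℕ), 1 ≤ k → ∀ (a m2 : ℝ), amin ≤ a → a ≤ aplus → 0 ≤ m2 → m2 ≤ m2plus →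
      ∀ (μ : Fin (d + 1)) (x : Fin (d + 1) → ℤ) (F : Finset (Fin (d + 1) → ℤ)),
        ∑ z ∈ F, |(((ℓ + 1) ^ k : ℕ) : ℝ) * (GkLat ℓ k a m2 (x + Pi.single μ 1) z - GkLat ℓ k a m2 x z)|
            * Real.exp (δ₀ * supNorm (x - z) / (((ℓ + 1) ^ k : ℕ) : ℝ)) ≤ c₀ := by
  obtain ⟨δ₀, c₀, hδ₀, hc₀, h⟩ := Gfine_rowwD_bound d ℓ hℓ amin aplus m2plus ha
  refine ⟨δ₀, c₀, hδ₀, hc₀, ?_⟩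
  intro k hk a m2 h1 h2 h3 h4 μ x F
  have hn := one_le_n ℓ k
  have ha' : 0 < a := ha.trans_le h1
  set xe : Fin (d + 1) → ℤ := x + Pi.single μ 1 with hxe
  obtain ⟨R, hR⟩ := exists_labRad_finset ((ℓ + 1) ^ k) (insert x (insert xe F))
  have hxR : LabRad ((ℓ + 1) ^ k) R x := hR x (Finset.mem_insert_self _ _)
  have hxeR : LabRad ((ℓ + 1) ^ k) R xe := hR xe (Finset.mem_insert_of_mem (Finset.mem_insert_self _ _))
  have hFR : ∀ z ∈ F, LabRad ((ℓ + 1) ^ k) R z :=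
    fun z hz => hR z (Finset.mem_insert_of_mem (Finset.mem_insert_of_mem hz))
  have hB : ∀ t, R ≤ t → ∑ z ∈ F, |(((ℓ + 1) ^ k : ℕ) : ℝ) * (gcube ℓ k t a m2 xe z - gcube ℓ k t a m2 x z)|
      * Real.exp (δ₀ * supNorm (x - z) / (((ℓ + 1) ^ k : ℕ) : ℝ)) ≤ c₀ := by
    intro t ht
    have hxm := ctr_mem (d := d) hn ht hxR
    have hxem := ctr_mem (d := d) hn ht hxeR
    have hFm : ∀ z ∈ F, ctr ((ℓ + 1) ^ k) t z ∈ boxDom (Nf ℓ k (cubeM (d := d) t)) :=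
      fun z hz => ctr_mem (d := d) hn ht (hFR z hz)
    set G := Gfine ℓ k (cubeM (d := d) t) k a m2 with hG
    set g : ↥(boxDom (Nf ℓ k (cubeM (d := d) t))) → ℝ := fun y =>
      |(((ℓ + 1) ^ k : ℕ) : ℝ) * (G ⟨_, hxem⟩ y - G ⟨_, hxm⟩ y)|
        * Real.exp (δ₀ * supNorm (ctr ((ℓ + 1) ^ k) t x - y.1) / (((ℓ + 1) ^ k : ℕ) : ℝ)) with hg
    have hstep : (⟨ctr ((ℓ + 1) ^ k) t xe, hxem⟩ : ↥(boxDom (Nf ℓ k (cubeM (d := d) t)))).1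
        = (⟨ctr ((ℓ + 1) ^ k) t x, hxm⟩ : ↥(boxDom (Nf ℓ k (cubeM (d := d) t)))).1 + Pi.single μ 1 := by
      simp only [hxe, ctr_add_single]
    have hroww : ∑ y, g y ≤ c₀ := by
      have := h k hk k hk le_rfl a m2 h1 h2 h3 h4 (cubeM t) (cubeM_pos t) μ ⟨_, hxm⟩ ⟨_, hxem⟩ hstep
      simpa only [wsum, hg] using this
    set ι : ↥F → ↥(boxDom (Nf ℓ k (cubeM (d := d) t))) := fun y => ⟨ctr ((ℓ + 1) ^ k) t y.1, hFm y.1 y.2⟩ with hι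
    have hinj : Function.Injective ι := fun y₁ y₂ hy =>
      Subtype.ext (ctr_injective _ _ (congrArg Subtype.val hy))
    have hsum : ∑ z ∈ F, |(((ℓ + 1) ^ k : ℕ) : ℝ) * (gcube ℓ k t a m2 xe z - gcube ℓ k t a m2 x z)|
        * Real.exp (δ₀ * supNorm (x - z) / (((ℓ + 1) ^ k : ℕ) : ℝ)) = ∑ y ∈ F.attach, g (ι y) := by
      rw [← Finset.sum_attach]
      refine Finset.sum_congr rfl fun y _ => ?_
      simp only [hg, hι, gcube_eq hxem (hFm y.1 y.2), gcube_eq hxm (hFm y.1 y.2), ctr_sub_ctr, hG]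
    rw [hsum]
    exact (sum_attach_le_univ_sum F ι hinj g fun y => mul_nonneg (abs_nonneg _) (Real.exp_pos _).le).trans hroww
  have hlim : Tendsto (fun t => ∑ z ∈ F, |(((ℓ + 1) ^ k : ℕ) : ℝ) * (gcube ℓ k t a m2 xe z - gcube ℓ k t a m2 x z)|
      * Real.exp (δ₀ * supNorm (x - z) / (((ℓ + 1) ^ k : ℕ) : ℝ))) atTop
      (𝓝 (∑ z ∈ F, |(((ℓ + 1) ^ k : ℕ) : ℝ) * (GkLat ℓ k a m2 xe z - GkLat ℓ k a m2 x z)|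
        * Real.exp (δ₀ * supNorm (x - z) / (((ℓ + 1) ^ k : ℕ) : ℝ)))) :=
    tendsto_finsetSum F fun z _ =>
      ((((tendsto_gcube hℓ hk ha' h3 xe z).sub (tendsto_gcube hℓ hk ha' h3 x z)).const_mul _).abs).mul_const _
  exact le_of_tendsto hlim (eventually_atTop.2 ⟨R, hB⟩)

section DerivConsequences

variable {ℓ k : ℕ} {a m2 δ₀ c₀ : ℝ} {μ : Fin (d + 1)} {x : Fin (d + 1) → ℤ}

/-- the full weighted series of `∂^η_μG_k(0)(x,·)` converges and is `≤ c₀`, given the finite partial-sum bound of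
`GkLat_weightedRowD_le`. [cite: Balaban1983RegularityDecay, Theorem (Prop. 2.1 of [1]) (1.10) p.573, derivative clause; dictionary (Ω = ηℤ^{d+1}, A = 0)] -/
theorem GkLat_weightedRowD_summable_tsum_le
    (hF : ∀ F : Finset (Fin (d + 1) → ℤ),
      ∑ z ∈ F, |(((ℓ + 1) ^ k : ℕ) : ℝ) * (GkLat ℓ k a m2 (x + Pi.single μ 1) z - GkLat ℓ k a m2 x z)|
        * Real.exp (δ₀ * supNorm (x - z) / (((ℓ + 1) ^ k : ℕ) : ℝ)) ≤ c₀) :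
    (Summable fun z => |(((ℓ + 1) ^ k : ℕ) : ℝ) * (GkLat ℓ k a m2 (x + Pi.single μ 1) z - GkLat ℓ k a m2 x z)|
        * Real.exp (δ₀ * supNorm (x - z) / (((ℓ + 1) ^ k : ℕ) : ℝ))) ∧
      ∑' z, |(((ℓ + 1) ^ k : ℕ) : ℝ) * (GkLat ℓ k a m2 (x + Pi.single μ 1) z - GkLat ℓ k a m2 x z)|
        * Real.exp (δ₀ * supNorm (x - z) / (((ℓ + 1) ^ k : ℕ) : ℝ)) ≤ c₀ :=
  ⟨summable_of_sum_le (fun _ => mul_nonneg (abs_nonneg _) (Real.exp_pos _).le) hF,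
    Real.tsum_le_of_sum_le (fun _ => mul_nonneg (abs_nonneg _) (Real.exp_pos _).le) hF⟩

/-- **POINTWISE DECAY OF THE DIFFERENCED KERNEL**: `|n(G_k(0)(x+e_μ,z) − G_k(0)(x,z))| ≤ c₀e^{−δ₀|x−z|_∞/n}` — and, by the
symmetry `G_k(0)(x,z) = G_k(0)(z,x)` (`B3GkZeroLattice.GkLat_comm`), the same bound for the difference in the second variable.
[cite: Balaban1983RegularityDecay, Theorem (Prop. 2.1 of [1]) (1.10) p.573, derivative clause; dictionary (Ω = ηℤ^{d+1}, A = 0, f = δ_z)] -/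
theorem GkLatD_abs_le
    (hF : ∀ F : Finset (Fin (d + 1) → ℤ),
      ∑ z ∈ F, |(((ℓ + 1) ^ k : ℕ) : ℝ) * (GkLat ℓ k a m2 (x + Pi.single μ 1) z - GkLat ℓ k a m2 x z)|
        * Real.exp (δ₀ * supNorm (x - z) / (((ℓ + 1) ^ k : ℕ) : ℝ)) ≤ c₀) (z : Fin (d + 1) → ℤ) :
    |(((ℓ + 1) ^ k : ℕ) : ℝ) * (GkLat ℓ k a m2 (x + Pi.single μ 1) z - GkLat ℓ k a m2 x z)|
      ≤ c₀ * Real.exp (-(δ₀ * supNorm (x - z) / (((ℓ + 1) ^ k : ℕ) : ℝ))) := by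
  have h1 := hF {z}
  rw [Finset.sum_singleton] at h1
  rw [Real.exp_neg, ← div_eq_mul_inv, le_div_iff₀ (Real.exp_pos _)]
  exact h1

/-- **(1.10), DERIVATIVE CLAUSE, IN THE PRINTED SHAPE, `Ω = ηℤ^{d+1}`, `A = 0`**: for every bounded `f : ηℤ^{d+1} → ℂ`
(`‖f(z)‖ ≤ F_∞`) and every `D ≤ |x − z|_∞` on `supp f`, the series `(∂^η_μG_k(0)f)(x) = Σ_z n(G_k(0)(x+e_μ,z) − G_k(0)(x,z))f(z)`
converges absolutely and `|(∂^η_μG_k(0)f)(x)| ≤ c₀·e^{−δ₀D/n}·F_∞` — «|(D^η_{A,μ}G_k(Ω,A)f)(x)| ≦ c₀exp(−δ₀dist(x, supp f))‖f‖_∞».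
[cite: Balaban1983RegularityDecay, Theorem (Prop. 2.1 of [1]) (1.10) p.573, derivative clause; dictionary (Ω = ηℤ^{d+1}, A = 0, sup-norm distance in units of η)] -/
theorem GkLatD_apply_le
    (hF : ∀ F : Finset (Fin (d + 1) → ℤ),
      ∑ z ∈ F, |(((ℓ + 1) ^ k : ℕ) : ℝ) * (GkLat ℓ k a m2 (x + Pi.single μ 1) z - GkLat ℓ k a m2 x z)|
        * Real.exp (δ₀ * supNorm (x - z) / (((ℓ + 1) ^ k : ℕ) : ℝ)) ≤ c₀)
    (hδ₀ : 0 ≤ δ₀) {f : (Fin (d + 1) → ℤ) → ℂ} {Fsup D : ℝ} (hf : ∀ z, ‖f z‖ ≤ Fsup)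
    (hD : ∀ z, f z ≠ 0 → D ≤ supNorm (x - z)) :
    (Summable fun z =>
        (((((ℓ + 1) ^ k : ℕ) : ℝ) * (GkLat ℓ k a m2 (x + Pi.single μ 1) z - GkLat ℓ k a m2 x z) : ℝ) : ℂ) * f z) ∧
      ‖∑' z, (((((ℓ + 1) ^ k : ℕ) : ℝ) * (GkLat ℓ k a m2 (x + Pi.single μ 1) z - GkLat ℓ k a m2 x z) : ℝ) : ℂ) * f z‖
        ≤ c₀ * Real.exp (-(δ₀ * D / (((ℓ + 1) ^ k : ℕ) : ℝ))) * Fsup :=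
  tsum_mul_le_of_weighted hF hf fun z hz =>
    div_le_div_of_nonneg_right (mul_le_mul_of_nonneg_left (hD z hz) hδ₀) (Nat.cast_nonneg _)

end DerivConsequences

/-! ### (2.17) at `q = p = 1` for `G_k(0)∂^{η*}_μ` («by duality argument», p. 583) -/

/-- **(2.17) AT `q = p = 1` FOR `G_k(0)∂^{η*}_μ` ON `ηℤ^{d+1}`**: with the constants of `B4Thm19ZeroLattice.GkLat_weightedRowD_le`,
for every finitely supported `f` (support in `S`) and every axis `μ`:
`Σ_x |Σ_{z∈S} n(G_k(0)(z+e_μ,x) − G_k(0)(z,x))·f(z)| ≤ c₀·Σ_{z∈S}|f(z)|` — the kernel of `G_k(0)∂^{η*}_μ` at `(x,z)` is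
`n(G_k(0)(x,z+e_μ) − G_k(0)(x,z)) = n(G_k(0)(z+e_μ,x) − G_k(0)(z,x))` (`GkLat_comm`), whose sums over `x` are the ROW sums of the
differenced kernel bounded above («For q = p = 1 we get it by duality argument», p. 583).
[cite: Balaban1983RegularityDecay, Lemma 2.2 (2.17) p.578 (third operator); proof p.583; dictionary (□ ↦ ηℤ^{d+1}, A = 0)] -/
theorem GkLat_adjDeriv_apply_l1_le {ℓ k : ℕ} {a m2 δ₀ c₀ : ℝ} (hδ₀ : 0 ≤ δ₀) {μ : Fin (d + 1)}
    (hF : ∀ (x : Fin (d + 1) → ℤ) (F : Finset (Fin (d + 1) → ℤ)),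
      ∑ z ∈ F, |(((ℓ + 1) ^ k : ℕ) : ℝ) * (GkLat ℓ k a m2 (x + Pi.single μ 1) z - GkLat ℓ k a m2 x z)|
        * Real.exp (δ₀ * supNorm (x - z) / (((ℓ + 1) ^ k : ℕ) : ℝ)) ≤ c₀)
    (S : Finset (Fin (d + 1) → ℤ)) (f : (Fin (d + 1) → ℤ) → ℂ) :
    (Summable fun x => ‖∑ z ∈ S, (((((ℓ + 1) ^ k : ℕ) : ℝ) *
        (GkLat ℓ k a m2 (z + Pi.single μ 1) x - GkLat ℓ k a m2 z x) : ℝ) : ℂ) * f z‖) ∧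
      ∑' x, ‖∑ z ∈ S, (((((ℓ + 1) ^ k : ℕ) : ℝ) *
        (GkLat ℓ k a m2 (z + Pi.single μ 1) x - GkLat ℓ k a m2 z x) : ℝ) : ℂ) * f z‖
        ≤ c₀ * ∑ z ∈ S, ‖f z‖ := by
  set K : (Fin (d + 1) → ℤ) → (Fin (d + 1) → ℤ) → ℝ := fun z x =>
    (((ℓ + 1) ^ k : ℕ) : ℝ) * (GkLat ℓ k a m2 (z + Pi.single μ 1) x - GkLat ℓ k a m2 z x) with hKdef
  -- the rows of the differenced kernel are summable with sum `≤ c₀`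
  have hrow : ∀ z, Summable (fun x => |K z x|) ∧ ∑' x, |K z x| ≤ c₀ := fun z =>
    summable_abs_of_weighted (fun x => weight_nonneg hδ₀ _ (z - x)) (hF z)
  -- the majorant `Σ_{z∈S} |K z x|·‖f z‖`
  set g : (Fin (d + 1) → ℤ) → ℝ := fun x => ∑ z ∈ S, |K z x| * ‖f z‖ with hg
  have hgs : Summable g := summable_sum fun z _ => (hrow z).1.mul_right _
  have hmaj : ∀ x, ‖∑ z ∈ S, ((K z x : ℝ) : ℂ) * f z‖ ≤ g x := by
    intro x
    refine (norm_sum_le _ _).trans (le_of_eq (Finset.sum_congr rfl fun z _ => ?_))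
    rw [norm_mul, Complex.norm_real, Real.norm_eq_abs]
  refine ⟨Summable.of_nonneg_of_le (fun _ => norm_nonneg _) hmaj hgs, ?_⟩
  refine (Summable.tsum_le_tsum hmaj (Summable.of_nonneg_of_le (fun _ => norm_nonneg _) hmaj hgs) hgs).trans ?_
  rw [hg, Summable.tsum_finsetSum (fun z _ => (hrow z).1.mul_right _), Finset.mul_sum]
  refine Finset.sum_le_sum fun z _ => ?_
  rw [tsum_mul_right]
  calc (∑' x, |K z x|) * ‖f z‖ ≤ c₀ * ‖f z‖ := mul_le_mul_of_nonneg_right (hrow z).2 (norm_nonneg _)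
    _ = c₀ * ‖f z‖ := rfl


/-! ## §2 (1.9), the Hölder clause, for `Ω = ηℤ^{d+1}` -/

/-- kernel: **THE LIMIT STEP FOR THE HÖLDER FUNCTIONAL** — if, at fixed scale and window point, the two-centre weighted
box bound `wsum2 … ≤ c₀` of `B4Thm19ZeroBoxHolder` holds on every centred cube `C_t`, then the corresponding finite partial
sums for `G_k(0)` on the lattice are `≤ c₀` (centre the points, `gcube_eq`, `tendsto_gcube`, `le_of_tendsto`). [folklore] -/
private theorem rowH_limit {ℓ k : ℕ} (hℓ : 1 ≤ ℓ) (hk : 1 ≤ k) {a m2 : ℝ} (ha : 0 < a) (hm : 0 ≤ m2) (δ₀ c₀ α : ℝ)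
    (μ : Fin (d + 1)) (x x' : Fin (d + 1) → ℤ) (hne : x' ≠ x) (F : Finset (Fin (d + 1) → ℤ))
    (hbox : ∀ (t : ℕ) (y ye y' ye' : ↥(boxDom (Nf ℓ k (cubeM (d := d) t)))),
      ye.1 = y.1 + Pi.single μ 1 → ye'.1 = y'.1 + Pi.single μ 1 → y'.1 ≠ y.1 →
      wsum2 δ₀ ((ℓ + 1) ^ k) y y' (fun z => ((((ℓ + 1) ^ k : ℕ) : ℝ) / supNorm (y'.1 - y.1)) ^ α *
        ((((ℓ + 1) ^ k : ℕ) : ℝ) * ((Gfine ℓ k (cubeM t) k a m2 ye' z - Gfine ℓ k (cubeM t) k a m2 y' z)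
          - (Gfine ℓ k (cubeM t) k a m2 ye z - Gfine ℓ k (cubeM t) k a m2 y z)))) ≤ c₀) :
    ∑ z ∈ F, |((((ℓ + 1) ^ k : ℕ) : ℝ) / supNorm (x' - x)) ^ α * ((((ℓ + 1) ^ k : ℕ) : ℝ) *
          ((GkLat ℓ k a m2 (x' + Pi.single μ 1) z - GkLat ℓ k a m2 x' z)
            - (GkLat ℓ k a m2 (x + Pi.single μ 1) z - GkLat ℓ k a m2 x z)))|
        * Real.exp (δ₀ * min (supNorm (x - z)) (supNorm (x' - z)) / (((ℓ + 1) ^ k : ℕ) : ℝ)) ≤ c₀ := by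
  have hn := one_le_n ℓ k
  set xe : Fin (d + 1) → ℤ := x + Pi.single μ 1 with hxe
  set xe' : Fin (d + 1) → ℤ := x' + Pi.single μ 1 with hxe'
  obtain ⟨R, hR⟩ := exists_labRad_finset ((ℓ + 1) ^ k) (insert x (insert xe (insert x' (insert xe' F))))
  have hxR : LabRad ((ℓ + 1) ^ k) R x := hR x (by simp)
  have hxeR : LabRad ((ℓ + 1) ^ k) R xe := hR xe (by simp)
  have hx'R : LabRad ((ℓ + 1) ^ k) R x' := hR x' (by simp)
  have hxe'R : LabRad ((ℓ + 1) ^ k) R xe' := hR xe' (by simp)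
  have hFR : ∀ z ∈ F, LabRad ((ℓ + 1) ^ k) R z := fun z hz => hR z (by simp [hz])
  -- abbreviations for the weight and the Hölder prefactor
  set W : (Fin (d + 1) → ℤ) → ℝ := fun z =>
    Real.exp (δ₀ * min (supNorm (x - z)) (supNorm (x' - z)) / (((ℓ + 1) ^ k : ℕ) : ℝ)) with hW
  set P : ℝ := ((((ℓ + 1) ^ k : ℕ) : ℝ) / supNorm (x' - x)) ^ α with hP
  have hB : ∀ t, R ≤ t → ∑ z ∈ F, |P * ((((ℓ + 1) ^ k : ℕ) : ℝ) *
      ((gcube ℓ k t a m2 xe' z - gcube ℓ k t a m2 x' z) - (gcube ℓ k t a m2 xe z - gcube ℓ k t a m2 x z)))| * W z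
        ≤ c₀ := by
    intro t ht
    have hxm := ctr_mem (d := d) hn ht hxR
    have hxem := ctr_mem (d := d) hn ht hxeR
    have hx'm := ctr_mem (d := d) hn ht hx'R
    have hxe'm := ctr_mem (d := d) hn ht hxe'R
    have hFm : ∀ z ∈ F, ctr ((ℓ + 1) ^ k) t z ∈ boxDom (Nf ℓ k (cubeM (d := d) t)) :=
      fun z hz => ctr_mem (d := d) hn ht (hFR z hz)
    set G := Gfine ℓ k (cubeM (d := d) t) k a m2 with hG
    set g : ↥(boxDom (Nf ℓ k (cubeM (d := d) t))) → ℝ := fun y =>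
      |((((ℓ + 1) ^ k : ℕ) : ℝ) / supNorm (ctr ((ℓ + 1) ^ k) t x' - ctr ((ℓ + 1) ^ k) t x)) ^ α *
          ((((ℓ + 1) ^ k : ℕ) : ℝ) * ((G ⟨_, hxe'm⟩ y - G ⟨_, hx'm⟩ y) - (G ⟨_, hxem⟩ y - G ⟨_, hxm⟩ y)))|
        * Real.exp (δ₀ * min (supNorm (ctr ((ℓ + 1) ^ k) t x - y.1)) (supNorm (ctr ((ℓ + 1) ^ k) t x' - y.1))
          / (((ℓ + 1) ^ k : ℕ) : ℝ)) with hg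
    have hstep : (⟨ctr ((ℓ + 1) ^ k) t xe, hxem⟩ : ↥(boxDom (Nf ℓ k (cubeM (d := d) t)))).1
        = (⟨ctr ((ℓ + 1) ^ k) t x, hxm⟩ : ↥(boxDom (Nf ℓ k (cubeM (d := d) t)))).1 + Pi.single μ 1 := by
      simp only [hxe, ctr_add_single]
    have hstep' : (⟨ctr ((ℓ + 1) ^ k) t xe', hxe'm⟩ : ↥(boxDom (Nf ℓ k (cubeM (d := d) t)))).1
        = (⟨ctr ((ℓ + 1) ^ k) t x', hx'm⟩ : ↥(boxDom (Nf ℓ k (cubeM (d := d) t)))).1 + Pi.single μ 1 := by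
      simp only [hxe', ctr_add_single]
    have hne' : (⟨ctr ((ℓ + 1) ^ k) t x', hx'm⟩ : ↥(boxDom (Nf ℓ k (cubeM (d := d) t)))).1
        ≠ (⟨ctr ((ℓ + 1) ^ k) t x, hxm⟩ : ↥(boxDom (Nf ℓ k (cubeM (d := d) t)))).1 :=
      fun hc => hne (ctr_injective _ _ hc)
    have hroww : ∑ y, g y ≤ c₀ := by
      have := hbox t ⟨_, hxm⟩ ⟨_, hxem⟩ ⟨_, hx'm⟩ ⟨_, hxe'm⟩ hstep hstep' hne'
      simpa only [wsum2, hg] using this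
    set ι : ↥F → ↥(boxDom (Nf ℓ k (cubeM (d := d) t))) := fun y => ⟨ctr ((ℓ + 1) ^ k) t y.1, hFm y.1 y.2⟩ with hι
    have hinj : Function.Injective ι := fun y₁ y₂ hy =>
      Subtype.ext (ctr_injective _ _ (congrArg Subtype.val hy))
    have hsum : ∑ z ∈ F, |P * ((((ℓ + 1) ^ k : ℕ) : ℝ) *
        ((gcube ℓ k t a m2 xe' z - gcube ℓ k t a m2 x' z) - (gcube ℓ k t a m2 xe z - gcube ℓ k t a m2 x z)))| * W z
        = ∑ y ∈ F.attach, g (ι y) := by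
      rw [← Finset.sum_attach]
      refine Finset.sum_congr rfl fun y _ => ?_
      simp only [hg, hι, hP, hW, gcube_eq hxe'm (hFm y.1 y.2), gcube_eq hx'm (hFm y.1 y.2),
        gcube_eq hxem (hFm y.1 y.2), gcube_eq hxm (hFm y.1 y.2), ctr_sub_ctr, hG]
    rw [hsum]
    exact (sum_attach_le_univ_sum F ι hinj g fun y => mul_nonneg (abs_nonneg _) (Real.exp_pos _).le).trans hroww
  have hlim : Tendsto (fun t => ∑ z ∈ F, |P * ((((ℓ + 1) ^ k : ℕ) : ℝ) *
      ((gcube ℓ k t a m2 xe' z - gcube ℓ k t a m2 x' z) - (gcube ℓ k t a m2 xe z - gcube ℓ k t a m2 x z)))| * W z)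
      atTop (𝓝 (∑ z ∈ F, |P * ((((ℓ + 1) ^ k : ℕ) : ℝ) *
        ((GkLat ℓ k a m2 xe' z - GkLat ℓ k a m2 x' z) - (GkLat ℓ k a m2 xe z - GkLat ℓ k a m2 x z)))| * W z)) :=
    tendsto_finsetSum F fun z _ =>
      ((((((tendsto_gcube hℓ hk ha hm xe' z).sub (tendsto_gcube hℓ hk ha hm x' z)).sub
        ((tendsto_gcube hℓ hk ha hm xe z).sub (tendsto_gcube hℓ hk ha hm x z))).const_mul _).const_mul _).abs).mul_const _
  exact le_of_tendsto hlim (eventually_atTop.2 ⟨R, hB⟩)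

/-- **(1.9), THE HÖLDER CLAUSE, FOR `Ω = ηℤ^{d+1}`, `A = 0`, `0 ≤ α < 1` — THE UNIFORM TWO-CENTRE WEIGHTED BOUND, finite partial
sums.**  There are `δ₀, c₀ > 0` (depending on `d`, `L`, the window and `α`) such that for every `k ≥ 1`, window point, axis `μ`,
points `x ≠ x′` and finite `F ⊂ ℤ^{d+1}`:
`Σ_{z∈F} |(n/|x′−x|_∞)^α · n((G_k(0)(x′+e_μ,z) − G_k(0)(x′,z)) − (G_k(0)(x+e_μ,z) − G_k(0)(x,z)))|·e^{δ₀min(|x−z|_∞,|x′−z|_∞)/n} ≤ c₀`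
— the box theorem `B4Thm19ZeroBoxHolder.Gfine_rowwH_bound` on the centred cubes, in the limit `t → ∞`.
[cite: Balaban1983RegularityDecay, Theorem (Prop. 2.1 of [1]) (1.9) p.573; dictionary (Ω = ηℤ^{d+1}, A = 0, U ≡ 1, |x−x′| ↦ sup norm)] -/
theorem GkLat_weightedRowH_le (d ℓ : ℕ) (hℓ : 1 ≤ ℓ) (amin aplus m2plus : ℝ) (ha : 0 < amin) {α : ℝ}
    (hα0 : 0 ≤ α) (hα1 : α < 1) :
    ∃ δ₀ c₀ : ℝ, 0 < δ₀ ∧ 0 < c₀ ∧ ∀ (k : ℕ), 1 ≤ k → ∀ (a m2 : ℝ), amin ≤ a → a ≤ aplus → 0 ≤ m2 → m2 ≤ m2plus →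
      ∀ (μ : Fin (d + 1)) (x x' : Fin (d + 1) → ℤ), x' ≠ x → ∀ (F : Finset (Fin (d + 1) → ℤ)),
        ∑ z ∈ F, |((((ℓ + 1) ^ k : ℕ) : ℝ) / supNorm (x' - x)) ^ α * ((((ℓ + 1) ^ k : ℕ) : ℝ) *
              ((GkLat ℓ k a m2 (x' + Pi.single μ 1) z - GkLat ℓ k a m2 x' z)
                - (GkLat ℓ k a m2 (x + Pi.single μ 1) z - GkLat ℓ k a m2 x z)))|
            * Real.exp (δ₀ * min (supNorm (x - z)) (supNorm (x' - z)) / (((ℓ + 1) ^ k : ℕ) : ℝ)) ≤ c₀ := by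
  obtain ⟨δ₀, c₀, hδ₀, hc₀, h⟩ := Gfine_rowwH_bound d ℓ hℓ amin aplus m2plus ha hα0 hα1
  refine ⟨δ₀, c₀, hδ₀, hc₀, ?_⟩
  intro k hk a m2 h1 h2 h3 h4 μ x x' hne F
  exact rowH_limit hℓ hk (ha.trans_le h1) h3 δ₀ c₀ α μ x x' hne F fun t y ye y' ye' hye hye' hne' =>
    h k hk k hk le_rfl a m2 h1 h2 h3 h4 (cubeM t) (cubeM_pos t) μ y ye y' ye' hye hye' hne'

/-- **(1.9) WITH THE PRINTED ORDER OF QUANTIFIERS — THE RATE `δ₀` UNIFORM IN `α`**: «there exist positive constants δ₀, c₀, …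
depending on d, M only, c₀ on α also»: ONE `δ₀ > 0` (on `d`, `L`, the window) such that for every `0 ≤ α < 1` there is
`c₀(α) > 0` with the two-centre weighted bound of `GkLat_weightedRowH_le` — the `α`-uniform box theorem
`B4Thm19ZeroBoxHolderRateUnif.Gfine_rowwH_bound_unif` in the limit (reading note G-B4-p17-03 on the quantifier order).
[cite: Balaban1983RegularityDecay, Theorem (Prop. 2.1 of [1]) (1.9) p.573 («δ₀ … depending on d, M only, c₀ on α also»); dictionary (Ω = ηℤ^{d+1}, A = 0)] -/
theorem GkLat_weightedRowH_le_unif (d ℓ : ℕ) (hℓ : 1 ≤ ℓ) (amin aplus m2plus : ℝ) (ha : 0 < amin) :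
    ∃ δ₀ : ℝ, 0 < δ₀ ∧ ∀ (α : ℝ), 0 ≤ α → α < 1 → ∃ c₀ : ℝ, 0 < c₀ ∧
      ∀ (k : ℕ), 1 ≤ k → ∀ (a m2 : ℝ), amin ≤ a → a ≤ aplus → 0 ≤ m2 → m2 ≤ m2plus →
      ∀ (μ : Fin (d + 1)) (x x' : Fin (d + 1) → ℤ), x' ≠ x → ∀ (F : Finset (Fin (d + 1) → ℤ)),
        ∑ z ∈ F, |((((ℓ + 1) ^ k : ℕ) : ℝ) / supNorm (x' - x)) ^ α * ((((ℓ + 1) ^ k : ℕ) : ℝ) *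
              ((GkLat ℓ k a m2 (x' + Pi.single μ 1) z - GkLat ℓ k a m2 x' z)
                - (GkLat ℓ k a m2 (x + Pi.single μ 1) z - GkLat ℓ k a m2 x z)))|
            * Real.exp (δ₀ * min (supNorm (x - z)) (supNorm (x' - z)) / (((ℓ + 1) ^ k : ℕ) : ℝ)) ≤ c₀ := by
  obtain ⟨δ₀, hδ₀, hA⟩ := Gfine_rowwH_bound_unif d ℓ hℓ amin aplus m2plus ha
  refine ⟨δ₀, hδ₀, fun α hα0 hα1 => ?_⟩
  obtain ⟨c₀, hc₀, h⟩ := hA α hα0 hα1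
  refine ⟨c₀, hc₀, ?_⟩
  intro k hk a m2 h1 h2 h3 h4 μ x x' hne F
  exact rowH_limit hℓ hk (ha.trans_le h1) h3 δ₀ c₀ α μ x x' hne F fun t y ye y' ye' hye hye' hne' =>
    h k hk k hk le_rfl a m2 h1 h2 h3 h4 (cubeM t) (cubeM_pos t) μ y ye y' ye' hye hye' hne'

/-- **(1.9) IN THE PRINTED SHAPE, `Ω = ηℤ^{d+1}`, `A = 0`, `0 ≤ α < 1`**: with the constants of `GkLat_weightedRowH_le`, for every
bounded `f : ηℤ^{d+1} → ℂ` (`‖f(z)‖ ≤ F_∞`), every pair `x ≠ x′`, axis `μ` and every `D ≤ min(|x − z|_∞, |x′ − z|_∞)` on `supp f`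
(e.g. the sup-distance of `{x,x′}` to `supp f`), the series defining
`(n/|x′−x|_∞)^α·((∂^η_μG_k(0)f)(x′) − (∂^η_μG_k(0)f)(x))` converges absolutely and its norm is `≤ c₀·e^{−δ₀D/n}·F_∞` —
«(1/|x−x′|^α)|(D^η_{A,μ}G_k(Ω,A)f)(x′) − (D^η_{A,μ}G_k(Ω,A)f)(x)| ≦ c₀exp(−δ₀dist({x,x′}, supp f))‖f‖_∞» (`U ≡ 1` at `A = 0`;
`(n/|x′−x|_∞)^α = (η|x′−x|_∞)^{−α}`).
[cite: Balaban1983RegularityDecay, Theorem (Prop. 2.1 of [1]) (1.9) p.573; dictionary (Ω = ηℤ^{d+1}, A = 0, sup-norm distances in units of η)] -/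
theorem GkLatH_apply_le {ℓ k : ℕ} {a m2 δ₀ c₀ α : ℝ} {μ : Fin (d + 1)} {x x' : Fin (d + 1) → ℤ}
    (hF : ∀ F : Finset (Fin (d + 1) → ℤ),
      ∑ z ∈ F, |((((ℓ + 1) ^ k : ℕ) : ℝ) / supNorm (x' - x)) ^ α * ((((ℓ + 1) ^ k : ℕ) : ℝ) *
            ((GkLat ℓ k a m2 (x' + Pi.single μ 1) z - GkLat ℓ k a m2 x' z)
              - (GkLat ℓ k a m2 (x + Pi.single μ 1) z - GkLat ℓ k a m2 x z)))|
          * Real.exp (δ₀ * min (supNorm (x - z)) (supNorm (x' - z)) / (((ℓ + 1) ^ k : ℕ) : ℝ)) ≤ c₀)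
    (hδ₀ : 0 ≤ δ₀) {f : (Fin (d + 1) → ℤ) → ℂ} {Fsup D : ℝ} (hf : ∀ z, ‖f z‖ ≤ Fsup)
    (hD : ∀ z, f z ≠ 0 → D ≤ min (supNorm (x - z)) (supNorm (x' - z))) :
    (Summable fun z => ((((((ℓ + 1) ^ k : ℕ) : ℝ) / supNorm (x' - x)) ^ α * ((((ℓ + 1) ^ k : ℕ) : ℝ) *
            ((GkLat ℓ k a m2 (x' + Pi.single μ 1) z - GkLat ℓ k a m2 x' z)
              - (GkLat ℓ k a m2 (x + Pi.single μ 1) z - GkLat ℓ k a m2 x z))) : ℝ) : ℂ) * f z) ∧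
      ‖∑' z, ((((((ℓ + 1) ^ k : ℕ) : ℝ) / supNorm (x' - x)) ^ α * ((((ℓ + 1) ^ k : ℕ) : ℝ) *
            ((GkLat ℓ k a m2 (x' + Pi.single μ 1) z - GkLat ℓ k a m2 x' z)
              - (GkLat ℓ k a m2 (x + Pi.single μ 1) z - GkLat ℓ k a m2 x z))) : ℝ) : ℂ) * f z‖
        ≤ c₀ * Real.exp (-(δ₀ * D / (((ℓ + 1) ^ k : ℕ) : ℝ))) * Fsup :=
  tsum_mul_le_of_weighted hF hf fun z hz =>
    div_le_div_of_nonneg_right (mul_le_mul_of_nonneg_left (hD z hz) hδ₀) (Nat.cast_nonneg _)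

/-! ## §3 Non-vacuity: the hypotheses are met (`d + 1 = 4`, `L = 2`, window `a ∈ [1/2, 2]`, `m² ∈ [0, 1]`, `α = 1/2`) -/

/-- the derivative clause at the physical dimension `d + 1 = 4`, `L = 2`. -/
example : ∃ δ₀ c₀ : ℝ, 0 < δ₀ ∧ 0 < c₀ ∧ ∀ (k : ℕ), 1 ≤ k → ∀ (a m2 : ℝ), (1 / 2 : ℝ) ≤ a → a ≤ 2 → 0 ≤ m2 → m2 ≤ 1 →
      ∀ (μ : Fin (3 + 1)) (x : Fin (3 + 1) → ℤ) (F : Finset (Fin (3 + 1) → ℤ)),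
        ∑ z ∈ F, |(((1 + 1) ^ k : ℕ) : ℝ) * (GkLat 1 k a m2 (x + Pi.single μ 1) z - GkLat 1 k a m2 x z)|
            * Real.exp (δ₀ * supNorm (x - z) / (((1 + 1) ^ k : ℕ) : ℝ)) ≤ c₀ :=
  GkLat_weightedRowD_le 3 1 le_rfl (1 / 2) 2 1 (by norm_num)

/-- the Hölder clause at `d + 1 = 4`, `L = 2`, `α = 1/2`. -/
example : ∃ δ₀ c₀ : ℝ, 0 < δ₀ ∧ 0 < c₀ ∧ ∀ (k : ℕ), 1 ≤ k → ∀ (a m2 : ℝ), (1 / 2 : ℝ) ≤ a → a ≤ 2 → 0 ≤ m2 → m2 ≤ 1 →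
      ∀ (μ : Fin (3 + 1)) (x x' : Fin (3 + 1) → ℤ), x' ≠ x → ∀ (F : Finset (Fin (3 + 1) → ℤ)),
        ∑ z ∈ F, |((((1 + 1) ^ k : ℕ) : ℝ) / supNorm (x' - x)) ^ (1 / 2 : ℝ) * ((((1 + 1) ^ k : ℕ) : ℝ) *
              ((GkLat 1 k a m2 (x' + Pi.single μ 1) z - GkLat 1 k a m2 x' z)
                - (GkLat 1 k a m2 (x + Pi.single μ 1) z - GkLat 1 k a m2 x z)))|
            * Real.exp (δ₀ * min (supNorm (x - z)) (supNorm (x' - z)) / (((1 + 1) ^ k : ℕ) : ℝ)) ≤ c₀ :=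
  GkLat_weightedRowH_le 3 1 le_rfl (1 / 2) 2 1 (by norm_num) (by norm_num) (by norm_num)

/-- the quantifier prefix is inhabited (`k = 1`, `a = 1`, `m² = 0`, two distinct points). -/
example : (1 : ℕ) ≤ 1 ∧ (1 / 2 : ℝ) ≤ 1 ∧ (1 : ℝ) ≤ 2 ∧ (0 : ℝ) ≤ 0 ∧ (0 : ℝ) ≤ 1 ∧
    (fun _ => (1 : ℤ) : Fin (3 + 1) → ℤ) ≠ (fun _ => 0) :=
  ⟨le_rfl, by norm_num, by norm_num, le_rfl, by norm_num, fun h => by simpa using congrFun h 0⟩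

end

end Literature.MathematicalPhysics.QuantumFieldTheory.Balaban1983to89.B4Thm19ZeroLattice
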